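import Literature.NumberTheory.LFunctions.WeilFirstPrimeCertificate
import Literature.NumberTheory.LFunctions.WeilFirstPrimeMinorantV
import Literature.NumberTheory.LFunctions.WeilFirstPrimeQuadratic
import HarnessLib

/-!
# The Stage-C first-prime certificate format and its soundness

Topic: `Literature/NumberTheory/LFunctions`. `WeilCert3` = the archimedean certificate format
`WeilCert` + dyadic exponent `j` + integer-checked first-prime cells (`FPDCell.checkZ`,
`checkCells₃`) + support `b` + the claimed table of SCALED moments `nuScale · ν_q`. The soundness
theorem **`WeilCert3.weilFirstPrimeQuadratic_nonneg_of_check`** (`c.check = true → 0 ≤ weilFirstPrimeQuadratic g` (`E₂ ≥ 0`) on `C(b)`)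
is that of `WeilFirstPrimeCertificate.lean` with three sharpenings needed at margin `~5·10⁻⁸`:
twenty-digit `1/(2π)` on both sides (the upper one through the scaling `nuScale` of the moment table,
so that the block machinery of `WeilCert` applies verbatim), the twelve-digit `log π` and `ψ(1/4)`
(`WeilSharpConstants.lean`), and the sup bound `|γ| ≤ max_j bnd_j` in the price of the signed
minorant. Everything here is proved; no named facts.

## References

* H. Yoshida, *On Hermitian forms attached to zeta functions*, Adv. Stud. Pure Math. 21 (1992),
  §2 (2.1), §6, Theorem 1 (p. 310). [Yoshida1992]
-/

noncomputable section

open Complex Finset MeasureTheory Set Filter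
open scoped Real Topology ComplexConjugate BigOperators

namespace Literature.NumberTheory.LFunctions

open Literature.Analysis.ValidatedNumerics.Numerics
open Literature.Analysis.SpecialFunctions

/-- A Stage-C certificate for first-prime Weil positivity on `C(b)`, `b ≤ a₀`: the archimedean
certificate format (whose `cells` field is unused) + dyadic exponent + integer-checked first-prime
cells + the support `b` + the claimed (scaled) moment table. [folklore] -/
structure WeilCert3 where
  /-- parameters, rounding, change of basis and PSD factors (format of `WeilCert`) -/
  base : WeilCert
  /-- the dyadic exponent of the cell end points (`u = a/2^j`) -/
  j : ℕ
  /-- tolerance bits of the claimed moment table (`|ν̃_q − nuScale·ν_q| ≤ 2^{-pnu}`) -/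
  pnu : ℕ
  /-- the cells of the first-prime minorant on `[0, T]` -/
  cells : List FPDCell
  /-- the support half-length of the target cone (`tsupport g ⊆ [-b, b]`, `b ≤ a₀`) -/
  b : ℚ
  /-- the claimed table of SCALED moments `nuScale · ν_q`, `q ≤ 2N` (verified against `nuQ` by
  `checkNu`; the scaling by `nuScale = invTwoPiHi20/invTwoPiHi` makes the archimedean block matrix
  `Sym − invTwoPiHi · Ĝ` of `WeilCert` the sharp one, `Sym − invTwoPiHi20 · Ĝ(ν)`) -/
  nuData : List ℚ

namespace WeilCert3

variable (c : WeilCert3)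

/-- The scaled moments `ν_q = a₀^q ∫ γ(t) t^q dt` of the first-prime minorant. [folklore] -/
def nuQ (q : ℕ) : ℚ := c.base.a0 ^ q * (2 * cellsMomentQ₂ c.base.wL c.cells q)

/-- Table of `ν_q`, `q ≤ 2N`: the claimed data (see `checkNu`). [folklore] -/
def nuTab : List ℚ := c.nuData

/-- Entry `q` of the claimed table is the scaled moment `nuScale · ν_q` up to `2^{-pnu}` (the table is
stored rounded to the dyadic grid, which keeps its literals — hence the block checks — small). [folklore] -/
def checkNuAt (q : ℕ) : Bool := decide (|getV c.nuData q - nuScale * c.nuQ q| ≤ 1 / 2 ^ c.pnu)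

/-- The claimed moment table is correct at the even indices `q ≤ 2N` (the only ones the reduced
quadratic form reads). [folklore] -/
def checkNu : Bool := allBelow (c.base.N + 1) fun j ↦ c.checkNuAt (2 * j)

/-- `ν'_abs = 2 a₀^{N+1} · (2 Σ_j bnd_j ∫_{cell j} s^{N+1}) / (N+1)!`: the `|γ|`-moment bound of the Taylor
remainder on the frequency side (signed minorant). [folklore] -/
def nuPrimeAbs : ℚ :=
  2 * (c.base.a0 ^ (c.base.N + 1) * (2 * cellsAbsMomentQ c.base.wL c.cells (c.base.N + 1))) /
    (c.base.N + 1).factorial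

/-- The coefficient of `‖g‖₂²` after all reductions, before rounding: level minus `log π`, minus
the price `7 (q_hi − q_lo) Σ_j bnd_j` of replacing `1/(2π)` by rationals against a SIGNED `γ`, minus
the Taylor/rounding remainders. [folklore] -/
def kappaExact : ℚ :=
  c.base.wL - logPiHi20 - 7 * (invTwoPiHi20 - invTwoPiLo20) * cellsBndMaxQ c.base.wL c.cells -
    2 * c.base.a0 * (c.base.etaP + 5 * invTwoPiHi20 * c.nuPrimeAbs +
      ((c.base.N : ℚ) + 1) ^ 2 * (1 / 2 ^ c.base.pg + invTwoPiHi / 2 ^ c.pnu))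

/-- `κ = rd(κ_exact)`. [folklore] -/
def kappaQ : ℚ := ratRd c.base.pg c.kappaExact

/-- Scalar side conditions (`0 < b ≤ a₀ ≤ 1`, frequency cut-off vs `N`, Taylor remainder `≤ 1`,
even `N + 1`, `κ ≥ 0`). [folklore] -/
def checkScalars : Bool :=
  decide (1 ≤ c.j) && decide (0 < c.b) && decide (c.b ≤ c.base.a0) && decide (c.base.a0 ≤ 1) &&
    decide (0 < c.base.T) && decide (2 * c.base.a0 * c.base.T ≤ (c.base.N : ℚ) + 2) &&
    decide (2 * (c.base.a0 * c.base.T) ^ (c.base.N + 1) / (c.base.N + 1).factorial ≤ 1) &&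
    decide (c.base.N + 1 = 2 * c.base.nb) && decide (0 ≤ c.kappaQ)

/-- **The checker.** [folklore] -/
def check : Bool :=
  checkCells₃ c.base.prec c.j c.base.wL c.base.T c.base.mwT c.cells && c.checkScalars && c.checkNu &&
    c.base.checkBlockK c.nuTab c.kappaQ 0 && c.base.checkBlockK c.nuTab c.kappaQ 1

end WeilCert3

namespace WeilCert3

variable {c : WeilCert3}

/-- Unpacking `check`. [folklore] -/
theorem check_spec (h : c.check = true) :
    checkCells₃ c.base.prec c.j c.base.wL c.base.T c.base.mwT c.cells = true ∧ c.checkScalars = true ∧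
      c.checkNu = true ∧
      c.base.checkBlockK c.nuTab c.kappaQ 0 = true ∧ c.base.checkBlockK c.nuTab c.kappaQ 1 = true := by
  unfold check at h
  simp only [Bool.and_eq_true] at h
  exact ⟨h.1.1.1.1, h.1.1.1.2, h.1.1.2, h.1.2, h.2⟩

/-- Unpacking `checkScalars`. [folklore] -/
theorem scalars_spec (h : c.checkScalars = true) :
    1 ≤ c.j ∧ 0 < c.b ∧ c.b ≤ c.base.a0 ∧ c.base.a0 ≤ 1 ∧ 0 < c.base.T ∧
      2 * c.base.a0 * c.base.T ≤ (c.base.N : ℚ) + 2 ∧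
      2 * (c.base.a0 * c.base.T) ^ (c.base.N + 1) / (c.base.N + 1).factorial ≤ 1 ∧
      c.base.N + 1 = 2 * c.base.nb ∧ 0 ≤ c.kappaQ := by
  unfold checkScalars at h
  simp only [Bool.and_eq_true, decide_eq_true_eq] at h
  exact ⟨h.1.1.1.1.1.1.1.1, h.1.1.1.1.1.1.1.2, h.1.1.1.1.1.1.2, h.1.1.1.1.1.2, h.1.1.1.1.2, h.1.1.1.2,
    h.1.1.2, h.1.2, h.2⟩

/-- The table of moments agrees with `nuScale · nuQ` at even `q ≤ 2N` up to `2^{-pnu}`. [folklore] -/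
theorem abs_getV_nuTab_sub_le (h : c.checkNu = true) {q : ℕ} (hq : q ≤ 2 * c.base.N) (he : q % 2 = 0) :
    |getV c.nuTab q - nuScale * c.nuQ q| ≤ 1 / 2 ^ c.pnu := by
  unfold checkNu at h
  have := of_allBelow h (k := q / 2) (by omega)
  unfold checkNuAt at this
  rw [show 2 * (q / 2) = q by omega] at this
  simpa [nuTab] using this

/-- Range-restricted rounding error of a quadratic form (`WeilAlg.quad_rounding_le` with the entrywise
hypothesis only for `k, l < m`). [folklore] -/
theorem quad_rounding_le' (m : ℕ) (A B : ℕ → ℕ → ℝ) (δ L : ℝ) (hδ0 : 0 ≤ δ)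
    (hδ : ∀ k < m, ∀ l < m, |A k l - B k l| ≤ δ) (M : ℕ → ℂ) (hM : ∀ k, ‖M k‖ ≤ L) :
    ∑ k ∈ range m, ∑ l ∈ range m, A k l * (conj (M k) * M l).re -
        ∑ k ∈ range m, ∑ l ∈ range m, B k l * (conj (M k) * M l).re ≤
      δ * (m : ℝ) ^ 2 * L ^ 2 := by
  have hAA : ∑ k ∈ range m, ∑ l ∈ range m, A k l * (conj (M k) * M l).re =
      ∑ k ∈ range m, ∑ l ∈ range m, (if k < m ∧ l < m then A k l else B k l) * (conj (M k) * M l).re := by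
    refine Finset.sum_congr rfl fun k hk ↦ Finset.sum_congr rfl fun l hl ↦ ?_
    rw [if_pos ⟨Finset.mem_range.1 hk, Finset.mem_range.1 hl⟩]
  rw [hAA]
  refine WeilAlg.quad_rounding_le m (fun k l ↦ if k < m ∧ l < m then A k l else B k l) B δ L
    (fun k l ↦ ?_) M hM
  show |(if k < m ∧ l < m then A k l else B k l) - B k l| ≤ δ
  split_ifs with hkl
  · exact hδ k hkl.1 l hkl.2
  · simpa using hδ0

/-! ### Moments of the minorant, all parities -/

/-- `∫ γ(t) t^q dt = 2 Σ_j momentQ_j(q)` for even `q`, `= 0` for odd `q`; and integrability. [folklore] -/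
theorem integral_gamma_pow (hcells : CellsOK c.base.wL c.base.T c.cells) (q : ℕ) :
    Integrable (fun t ↦ cellsGamma₂ c.base.wL c.cells t * t ^ q) ∧
      ∫ t, cellsGamma₂ c.base.wL c.cells t * t ^ q =
        if Even q then 2 * (cellsMomentQ₂ c.base.wL c.cells q : ℝ) else 0 := by
  rcases Nat.even_or_odd q with hq | hq
  · rw [if_pos hq]; exact integral_cellsGamma₂_mul_powV hcells hq
  · rw [if_neg (Nat.not_even_iff_odd.2 hq)]
    have h0 := (integral_abs_cellsGamma₂_mul_pow_leV hcells (Even.zero)).1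
    have h1 := (integral_abs_cellsGamma₂_mul_pow_leV hcells (hq.add_one)).1
    simp only [pow_zero, mul_one] at h0
    set γ := cellsGamma₂ c.base.wL c.cells with hγ
    have hint : Integrable (fun t ↦ γ t * t ^ q) := by
      refine Integrable.mono' (h0.add h1)
        (((measurable_cellsGamma₂ _ _).mul (measurable_id.pow_const q)).aestronglyMeasurable)
        (Eventually.of_forall fun t ↦ ?_)
      rw [Real.norm_eq_abs, abs_mul]
      simp only [Pi.add_apply]
      rw [show |γ t| + |γ t| * t ^ (q + 1) = |γ t| * (1 + t ^ (q + 1)) by ring]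
      refine mul_le_mul_of_nonneg_left ?_ (abs_nonneg _)
      rw [abs_pow]
      rcases le_or_gt |t| 1 with ht | ht
      · have : |t| ^ q ≤ 1 := pow_le_one₀ (abs_nonneg t) ht
        have : 0 ≤ t ^ (q + 1) := by rw [← (hq.add_one).pow_abs]; positivity
        linarith
      · have : |t| ^ q ≤ |t| ^ (q + 1) := pow_le_pow_right₀ ht.le (Nat.le_succ q)
        rw [(hq.add_one).pow_abs] at this
        linarith
    refine ⟨hint, ?_⟩
    have hodd : ∀ t, γ (-t) * (-t) ^ q = -(γ t * t ^ q) := by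
      intro t; rw [hγ, WeilCert2.cellsGamma₂_neg, hq.neg_pow]; ring
    have h := integral_neg_eq_self (fun t ↦ γ t * t ^ q) volume
    simp_rw [hodd] at h
    rw [integral_neg] at h
    linarith

/-- `ν_q = a₀^q ∫ γ(t) t^q dt` for even `q`. [folklore] -/
theorem nuQ_eq_integral (hcells : CellsOK c.base.wL c.base.T c.cells) {q : ℕ}
    (hq : Even q) :
    ((c.nuQ q : ℚ) : ℝ) = (c.base.a0 : ℝ) ^ q * ∫ t, cellsGamma₂ c.base.wL c.cells t * t ^ q := by
  rw [(integral_gamma_pow hcells q).2, if_pos hq]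
  unfold nuQ; push_cast; ring

/-! ### Step C: the frequency side -/

variable {g : ℝ → ℂ}

/-- The matrix `Ĝ` of the frequency side. [folklore] -/
def gHat (c : WeilCert3) (k l : ℕ) : ℝ :=
  if k % 2 = l % 2 then
    (-1 : ℝ) ^ k * (-1) ^ ((k + l) / 2) * ((c.nuQ (k + l) : ℚ) : ℝ) / (k.factorial * l.factorial)
  else 0

/-- **Frequency bound (signed minorant).**
`∫ ‖ĝ(1/2+it)‖² γ(t) dt ≤ Σ Ĝ_{kl} Re(conj M_k M_l) + 5 ‖g‖₁² ν'_abs`. [folklore] -/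
theorem freq_integral_bound (hcells : CellsOK c.base.wL c.base.T c.cells)
    (hsc : c.checkScalars = true) (hg : IsWeilTest g)
    (hsupp : tsupport g ⊆ Icc (-(c.base.a0 : ℝ)) c.base.a0) :
    ∫ t : ℝ, ‖weilMellin g (1 / 2 + t * I)‖ ^ 2 * cellsGamma₂ c.base.wL c.cells t ≤
      ∑ k ∈ range (c.base.N + 1), ∑ l ∈ range (c.base.N + 1),
          gHat c k l * (conj (weilMoment c.base.a0 g k) * weilMoment c.base.a0 g l).re +
        5 * weilNorm1 g ^ 2 * ((c.nuPrimeAbs : ℚ) : ℝ) := by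
  obtain ⟨-, hb0, hba, ha1, hT, haT, hρT, hN, -⟩ := scalars_spec hsc
  set a : ℝ := (c.base.a0 : ℝ) with ha_def
  have ha : 0 < a := by
    have h1 : (0 : ℝ) < c.b := by exact_mod_cast hb0
    have h2 : ((c.b : ℚ) : ℝ) ≤ c.base.a0 := by exact_mod_cast hba
    rw [ha_def]; linarith
  set γ : ℝ → ℝ := cellsGamma₂ c.base.wL c.cells with hγ
  set M : ℕ → ℂ := weilMoment a g with hM
  set n := c.base.N + 1 with hn
  set L := weilNorm1 g with hL
  have hn_even : Even n := ⟨c.base.nb, by omega⟩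
  -- the pointwise bound (signed): S·γ + R·|γ|
  set W : ℕ → ℕ → ℝ := fun k l ↦
    (((-1 : ℂ) ^ k * I ^ (k + l)) * (conj (M k) * M l)).re with hW
  have hpt : ∀ t : ℝ, ‖weilMellin g (1 / 2 + t * I)‖ ^ 2 * γ t ≤
      (∑ k ∈ range n, ∑ l ∈ range n,
        W k l * (a ^ (k + l) / (k.factorial * l.factorial)) * (γ t * t ^ (k + l))) +
        5 * L ^ 2 * (2 * a ^ n / n.factorial) * (|γ t| * t ^ n) := by
    intro t
    rcases lt_or_ge |t| (c.base.T : ℝ) with ht | ht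
    · have ht1 : 2 * a * |t| ≤ c.base.N + 2 := by
        have h1 : 2 * a * |t| ≤ 2 * a * c.base.T := by nlinarith
        have h2 : (2 * c.base.a0 * c.base.T : ℝ) ≤ c.base.N + 2 := by exact_mod_cast haT
        rw [ha_def] at h1 ⊢; linarith
      have ht2 : 2 * (|t| * a) ^ (c.base.N + 1) / (c.base.N + 1).factorial ≤ 1 := by
        have h1 : (|t| * a) ^ (c.base.N + 1) ≤ (c.base.T * a) ^ (c.base.N + 1) :=
          pow_le_pow_left₀ (by positivity) (by nlinarith) _
        have h2 : (2 * (c.base.a0 * c.base.T) ^ (c.base.N + 1) / (c.base.N + 1).factorial : ℝ) ≤ 1 := by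
          exact_mod_cast hρT
        rw [ha_def] at h1 ⊢
        rw [mul_comm (c.base.a0 : ℝ)] at h2
        have h3 : 2 * (|t| * ↑c.base.a0) ^ (c.base.N + 1) / ((c.base.N + 1).factorial : ℝ) ≤
            2 * (↑c.base.T * ↑c.base.a0) ^ (c.base.N + 1) / ((c.base.N + 1).factorial : ℝ) := by
          gcongr
        linarith
      have h := WeilCert2.freq_pointwise_bound_abs hg ha hsupp c.base.N ht1 ht2
      set S : ℝ := ∑ k ∈ range (c.base.N + 1), ∑ l ∈ range (c.base.N + 1),
          (((-1 : ℂ) ^ k * I ^ (k + l)) * (conj (M k) * M l)).re *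
            ((t * a) ^ (k + l) / (k.factorial * l.factorial)) with hS
      set R : ℝ := 5 * (2 * (|t| * a) ^ (c.base.N + 1) / (c.base.N + 1).factorial) * L ^ 2 with hR
      have hR0 : 0 ≤ R := by rw [hR]; positivity
      have hdiff : |‖weilMellin g (1 / 2 + t * I)‖ ^ 2 - S| ≤ R := by rw [hS, hR, hM]; exact h
      -- `φ γ = S γ + (φ − S) γ ≤ S γ + R |γ|`
      have hkey : ‖weilMellin g (1 / 2 + t * I)‖ ^ 2 * γ t ≤ S * γ t + R * |γ t| := by
        have e : ‖weilMellin g (1 / 2 + t * I)‖ ^ 2 * γ t =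
            S * γ t + (‖weilMellin g (1 / 2 + t * I)‖ ^ 2 - S) * γ t := by ring
        rw [e]
        have := abs_mul (‖weilMellin g (1 / 2 + t * I)‖ ^ 2 - S) (γ t)
        have h2 : |‖weilMellin g (1 / 2 + t * I)‖ ^ 2 - S| * |γ t| ≤ R * |γ t| :=
          mul_le_mul_of_nonneg_right hdiff (abs_nonneg _)
        linarith [le_abs_self ((‖weilMellin g (1 / 2 + t * I)‖ ^ 2 - S) * γ t)]
      refine hkey.trans (le_of_eq ?_)
      congr 1
      · rw [hS, Finset.sum_mul, ← hn]
        refine Finset.sum_congr rfl fun k _ ↦ ?_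
        rw [Finset.sum_mul]
        refine Finset.sum_congr rfl fun l _ ↦ ?_
        rw [hW, mul_pow]
        simp only
        ring
      · rw [hR, ← hn_even.pow_abs t, hn, mul_pow]
        ring
    · have h0 : γ t = 0 := cellsGamma₂_eq_zeroV hcells ht
      rw [h0]
      simp
  -- integrability of all terms
  obtain ⟨B, hB0, hB⟩ := exists_abs_cellsGamma₂_le c.base.wL c.cells
  have hiL : Integrable fun t : ℝ ↦ ‖weilMellin g (1 / 2 + t * I)‖ ^ 2 * γ t :=
    integrable_norm_sq_weilMellin_mul hg (measurable_cellsGamma₂ _ _) hB0 le_rfl (B := 0)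
      (fun t ↦ by simpa using hB t)
  have hiq : ∀ q, Integrable fun t ↦ γ t * t ^ q := fun q ↦ (integral_gamma_pow hcells q).1
  obtain ⟨hiabs, habsle⟩ := integral_abs_cellsGamma₂_mul_pow_leV hcells hn_even
  have hiR : Integrable fun t ↦ (∑ k ∈ range n, ∑ l ∈ range n,
      W k l * (a ^ (k + l) / (k.factorial * l.factorial)) * (γ t * t ^ (k + l))) +
      5 * L ^ 2 * (2 * a ^ n / n.factorial) * (|γ t| * t ^ n) := by
    refine Integrable.add (integrable_finsetSum _ fun k _ ↦ integrable_finsetSum _ fun l _ ↦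
      (hiq (k + l)).const_mul _) (hiabs.const_mul _)
  have hint := integral_mono hiL hiR hpt
  refine hint.trans ?_
  rw [integral_add (integrable_finsetSum _ fun k _ ↦ integrable_finsetSum _ fun l _ ↦
      (hiq (k + l)).const_mul _) (hiabs.const_mul _),
    integral_finsetSum _ fun k _ ↦ integrable_finsetSum _ fun l _ ↦ (hiq (k + l)).const_mul _]
  refine add_le_add (le_of_eq ?_) ?_
  · refine Finset.sum_congr rfl fun k _ ↦ ?_
    rw [integral_finsetSum _ fun l _ ↦ (hiq (k + l)).const_mul _]
    refine Finset.sum_congr rfl fun l _ ↦ ?_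
    rw [integral_const_mul, (integral_gamma_pow hcells (k + l)).2, gHat]
    by_cases hkl : k % 2 = l % 2
    · have hev : Even (k + l) := (WeilCert.mod_two_eq_iff_even k l).1 hkl
      rw [if_pos hkl, if_pos hev, hW]
      simp only
      rw [WeilAna.I_pow_even hev,
        show ((-1 : ℂ) ^ k * (-1) ^ ((k + l) / 2)) * (conj (M k) * M l) =
          (((-1 : ℝ) ^ k * (-1) ^ ((k + l) / 2) : ℝ) : ℂ) * (conj (M k) * M l) by push_cast; ring,
        Complex.re_ofReal_mul]
      unfold nuQ
      push_cast
      rw [hM, ha_def]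
      ring
    · have hodd : ¬ Even (k + l) := fun h ↦ hkl ((WeilCert.mod_two_eq_iff_even k l).2 h)
      rw [if_neg hkl, if_neg hodd]
      simp
  · rw [integral_const_mul]
    have hfac : 0 ≤ 5 * L ^ 2 * (2 * a ^ n / n.factorial) := by positivity
    have := mul_le_mul_of_nonneg_left habsle hfac
    refine this.trans (le_of_eq ?_)
    unfold nuPrimeAbs
    push_cast
    rw [hn, ha_def]
    ring

/-! ### Step B: the minorant -/

/-- **Minorant bound.** `wL · 2π ‖g‖₂² − ∫ ‖ĝ‖² γ ≤ ∫ ‖ĝ(1/2+it)‖² w₂(t) dt` with the first-prime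
weight `w₂(t) = Re ψ(1/4 + it/2) − √2 log 2 cos(t log 2)`. [folklore] -/
theorem arch_lower_bound (hcells : CellsOK c.base.wL c.base.T c.cells)
    (hg : IsWeilTest g) :
    (c.base.wL : ℝ) * (2 * π * weilNorm2Sq g) -
        ∫ t : ℝ, ‖weilMellin g (1 / 2 + t * I)‖ ^ 2 * cellsGamma₂ c.base.wL c.cells t ≤
      ∫ t : ℝ, ‖weilMellin g (1 / 2 + t * I)‖ ^ 2 *
        (Literature.Analysis.SpecialFunctions.reDigammaQuarter t -
          Real.sqrt 2 * Real.log 2 * Real.cos (t * Real.log 2)) := by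
  obtain ⟨B, hB0, hB⟩ := exists_abs_cellsGamma₂_le c.base.wL c.cells
  set σ : ℝ → ℝ := fun t ↦ (c.base.wL : ℝ) - cellsGamma₂ c.base.wL c.cells t with hσ
  have hσm : Measurable σ := measurable_const.sub (measurable_cellsGamma₂ _ _)
  have hσb : ∀ t, |σ t| ≤ (|(c.base.wL : ℝ)| + B) + 0 * t ^ 2 := fun t ↦ by
    rw [hσ, zero_mul, add_zero]
    exact (abs_sub _ _).trans (add_le_add le_rfl (hB t))
  have hle : ∀ t, σ t ≤ Literature.Analysis.SpecialFunctions.reDigammaQuarter t -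
      Real.sqrt 2 * Real.log 2 * Real.cos (t * Real.log 2) := fun t ↦ level_sub_cellsGamma₂_leV hcells t
  have hi1 : Integrable fun t : ℝ ↦ ‖weilMellin g (1 / 2 + t * I)‖ ^ 2 * σ t :=
    integrable_norm_sq_weilMellin_mul hg hσm (by positivity) le_rfl hσb
  have hi2a := integrable_norm_sq_weilMellin_mul_reDigammaQuarter hg
  have hi2b : Integrable fun t : ℝ ↦
      ‖weilMellin g (1 / 2 + t * I)‖ ^ 2 * (Real.sqrt 2 * Real.log 2 * Real.cos (t * Real.log 2)) :=
    integrable_norm_sq_weilMellin_mul hg (by fun_prop) (A := Real.sqrt 2 * Real.log 2) (B := 0)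
      (by positivity) le_rfl fun t ↦ by
        rw [zero_mul, add_zero, abs_mul, abs_of_nonneg (by positivity : (0 : ℝ) ≤ Real.sqrt 2 * Real.log 2)]
        exact mul_le_of_le_one_right (by positivity) (Real.abs_cos_le_one _)
  have hi2 : Integrable fun t : ℝ ↦ ‖weilMellin g (1 / 2 + t * I)‖ ^ 2 *
      (Literature.Analysis.SpecialFunctions.reDigammaQuarter t -
        Real.sqrt 2 * Real.log 2 * Real.cos (t * Real.log 2)) := by
    have e : (fun t : ℝ ↦ ‖weilMellin g (1 / 2 + t * I)‖ ^ 2 *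
        (Literature.Analysis.SpecialFunctions.reDigammaQuarter t -
          Real.sqrt 2 * Real.log 2 * Real.cos (t * Real.log 2))) =
        fun t : ℝ ↦ ‖weilMellin g (1 / 2 + t * I)‖ ^ 2 * Literature.Analysis.SpecialFunctions.reDigammaQuarter t -
          ‖weilMellin g (1 / 2 + t * I)‖ ^ 2 * (Real.sqrt 2 * Real.log 2 * Real.cos (t * Real.log 2)) := by
      funext t; ring
    rw [e]; exact hi2a.sub hi2b
  have h := integral_mono hi1 hi2 fun t ↦ mul_le_mul_of_nonneg_left (hle t) (sq_nonneg _)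
  refine le_trans (le_of_eq ?_) h
  have hj1 := integrable_norm_sq_weilMellin_half_line hg
  have hj2 : Integrable fun t : ℝ ↦ ‖weilMellin g (1 / 2 + t * I)‖ ^ 2 * cellsGamma₂ c.base.wL c.cells t :=
    integrable_norm_sq_weilMellin_mul hg (measurable_cellsGamma₂ _ _) hB0 le_rfl (B := 0)
      (fun t ↦ by simpa using hB t)
  have e : (fun t : ℝ ↦ ‖weilMellin g (1 / 2 + t * I)‖ ^ 2 * σ t) = fun t : ℝ ↦
      (c.base.wL : ℝ) * ‖weilMellin g (1 / 2 + t * I)‖ ^ 2 -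
        ‖weilMellin g (1 / 2 + t * I)‖ ^ 2 * cellsGamma₂ c.base.wL c.cells t := by
    funext t; rw [hσ]; ring
  rw [e, integral_sub (hj1.const_mul _) hj2, integral_const_mul,
    integral_norm_sq_weilMellin_half_line hg]

/-- The exact rational matrix `Sym − invTwoPiHi · Ĝ(nuScale · ν)` (the moment table replaced by the
scaled exact moments). [folklore] -/
def pmQexact (c : WeilCert3) (k l : ℕ) : ℚ :=
  if k % 2 = l % 2 then
    (-1 : ℚ) ^ k * 2 * c.base.tauQ k * c.base.tauQ l -
      invTwoPiHi * ((-1 : ℚ) ^ k * (-1 : ℚ) ^ ((k + l) / 2) * (nuScale * c.nuQ (k + l)) /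
        (k.factorial * l.factorial))
  else 0

/-- Table tolerance: `|pmQ ν̃ k l − pmQexact k l| ≤ invTwoPiHi · 2^{-pnu}` for `k, l ≤ N`. [folklore] -/
theorem abs_pmQ_sub_pmQexact_le (hnu : c.checkNu = true) {k l : ℕ} (hk : k < c.base.N + 1)
    (hl : l < c.base.N + 1) :
    |c.base.pmQ c.nuTab k l - pmQexact c k l| ≤ invTwoPiHi * (1 / 2 ^ c.pnu) := by
  have hq6 : (0 : ℚ) ≤ invTwoPiHi := by unfold invTwoPiHi piLo; norm_num
  unfold WeilCert.pmQ pmQexact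
  by_cases hkl : k % 2 = l % 2
  · have htab := abs_getV_nuTab_sub_le hnu (q := k + l) (by omega) (by omega)
    rw [if_pos hkl, if_pos hkl]
    have hf : (0 : ℚ) < (k.factorial : ℚ) * (l.factorial : ℚ) := by positivity
    have hff : (1 : ℚ) ≤ (k.factorial : ℚ) * (l.factorial : ℚ) := by
      have h1 : (1 : ℚ) ≤ k.factorial := by exact_mod_cast Nat.one_le_iff_ne_zero.2 (Nat.factorial_ne_zero k)
      have h2 : (1 : ℚ) ≤ l.factorial := by exact_mod_cast Nat.one_le_iff_ne_zero.2 (Nat.factorial_ne_zero l)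
      nlinarith
    have e : (-1 : ℚ) ^ k * 2 * c.base.tauQ k * c.base.tauQ l -
        invTwoPiHi * ((-1 : ℚ) ^ k * (-1 : ℚ) ^ ((k + l) / 2) * getV c.nuTab (k + l) /
          (k.factorial * l.factorial)) -
        ((-1 : ℚ) ^ k * 2 * c.base.tauQ k * c.base.tauQ l -
          invTwoPiHi * ((-1 : ℚ) ^ k * (-1 : ℚ) ^ ((k + l) / 2) * (nuScale * c.nuQ (k + l)) /
            (k.factorial * l.factorial))) =
        -(invTwoPiHi * ((-1 : ℚ) ^ k * (-1 : ℚ) ^ ((k + l) / 2)) / (k.factorial * l.factorial)) *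
          (getV c.nuTab (k + l) - nuScale * c.nuQ (k + l)) := by
      field_simp
      ring
    rw [e, abs_mul, abs_neg]
    have hsgn : |invTwoPiHi * ((-1 : ℚ) ^ k * (-1 : ℚ) ^ ((k + l) / 2)) / (k.factorial * l.factorial)| ≤
        invTwoPiHi := by
      rw [abs_div, abs_mul, abs_mul, abs_pow, abs_pow, abs_neg, abs_one, one_pow, one_pow, mul_one,
        abs_of_nonneg hq6, abs_of_pos hf, mul_one]
      exact div_le_self hq6 hff
    exact mul_le_mul hsgn htab (abs_nonneg _) hq6
  · rw [if_neg hkl, if_neg hkl, sub_self, abs_zero]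
    positivity

/-- Entry identity for the exact matrix: `(pmQexact k l : ℝ) = Sym_{kl} − q₂₀ Ĝ_{kl}` (the scaling turns the
six-digit `invTwoPiHi` of `WeilCert.pmQ` into `invTwoPiHi20`). [folklore] -/
theorem pmQexact_cast (k l : ℕ) :
    ((pmQexact c k l : ℚ) : ℝ) =
      (if k % 2 = l % 2 then
        (-1 : ℝ) ^ k * 2 * (((c.base.a0 : ℝ) / 2) ^ k / k.factorial) * (((c.base.a0 : ℝ) / 2) ^ l / l.factorial)
        else 0) -
      ((invTwoPiHi20 : ℚ) : ℝ) * gHat c k l := by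
  unfold pmQexact gHat
  by_cases hkl : k % 2 = l % 2
  · rw [if_pos hkl, if_pos hkl, if_pos hkl, ← invTwoPiHi_mul_nuScale]
    push_cast
    rw [WeilCert.tauQ_cast, WeilCert.tauQ_cast]
    ring
  · rw [if_neg hkl, if_neg hkl, if_neg hkl]
    all_goals simp

/-! ### The main theorem -/

set_option maxHeartbeats 1600000 in
/-- **Soundness of the Stage-C first-prime certificate.** If `c.check = true` then the first-prime
analytic form is non-negative on `C(b)`: for every test function `g` with `tsupport g ⊆ [-b, b]`,
`0 ≤ 2 Re(ĝ(0) conj ĝ(1)) − (log π)‖g‖₂² + (1/2π) ∫ |ĝ(1/2+it)|² w₂(t) dt` (`= E₂(g)`,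
`Literature.NumberTheory.LFunctions.weilFirstPrimeQuadratic`; for `b ≤ (log 3)/2` this is
`Re W(g ⋆ g̃)`, `weilQuadratic_re_eq_weilFirstPrimeQuadratic`). [folklore] -/
theorem weilFirstPrimeQuadratic_nonneg_of_check (h : c.check = true) {g : ℝ → ℂ} (hg : IsWeilTest g)
    (hsupp : tsupport g ⊆ Icc (-(c.b : ℝ)) c.b) : 0 ≤ weilFirstPrimeQuadratic g := by
  unfold weilFirstPrimeQuadratic weilFirstPrimeWeight
  obtain ⟨hcells3, hsc, hnuchk, hb0, hb1⟩ := check_spec h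
  have hcells : CellsOK c.base.wL c.base.T c.cells := cellsOK_of_checkCells₃ hcells3
  obtain ⟨-, hbpos, hba, ha1q, hT, haT, hρT, hN, hκ⟩ := scalars_spec hsc
  set a : ℝ := (c.base.a0 : ℝ) with ha_def
  have hba' : ((c.b : ℚ) : ℝ) ≤ a := by rw [ha_def]; exact_mod_cast hba
  have hb0' : (0 : ℝ) < c.b := by exact_mod_cast hbpos
  have ha : 0 < a := by linarith
  have ha1 : a ≤ 1 := by rw [ha_def]; exact_mod_cast ha1q
  have hsupp' : tsupport g ⊆ Icc (-a) a := hsupp.trans (Icc_subset_Icc (by linarith) hba')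
  set n := c.base.N + 1 with hn
  set nu := c.nuTab with hnu
  set M : ℕ → ℂ := weilMoment a g with hM
  set L := weilNorm1 g with hL
  set N2 := weilNorm2Sq g with hN2
  set z : ℕ → ℕ → ℝ := fun k l ↦ (conj (M k) * M l).re with hz
  have hzsym : ∀ k l, z k l = z l k := fun k l ↦ by
    rw [hz]; simp only; rw [← WeilAna.re_mul_conj_eq, mul_comm]
  have hL0 : 0 ≤ L := weilNorm1_nonneg g
  have hN20 : 0 ≤ N2 := weilNorm2Sq_nonneg g
  have hL1 : L ^ 2 ≤ 2 * a * N2 := weilNorm1_sq_le hg ha hsupp'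
  -- the three terms of E(g)
  set P : ℝ := 2 * (weilMellin g 0 * conj (weilMellin g 1)).re with hP
  set A : ℝ := ∫ t : ℝ, ‖weilMellin g (1 / 2 + t * I)‖ ^ 2 *
    (Literature.Analysis.SpecialFunctions.reDigammaQuarter t - Real.sqrt 2 * Real.log 2 * Real.cos (t * Real.log 2)) with hA
  set Γ : ℝ := ∫ t : ℝ, ‖weilMellin g (1 / 2 + t * I)‖ ^ 2 * cellsGamma₂ c.base.wL c.cells t with hΓ
  -- Step A
  set ρ : ℝ := 2 * (a / 2) ^ (c.base.N + 1) / (c.base.N + 1).factorial with hρ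
  have hρ0 : 0 ≤ ρ := by positivity
  have hPA : ∑ k ∈ range n, ∑ l ∈ range n,
      (2 * ((-a / 2) ^ k / k.factorial) * ((a / 2) ^ l / l.factorial)) * z k l -
      (8 * ρ + 6 * ρ ^ 2) * L ^ 2 ≤ P := WeilAna.polar_lower_bound hg ha ha1 hsupp' c.base.N
  rw [WeilCert.polar_symmetrize n a z hzsym] at hPA
  -- Step B
  have hB : (c.base.wL : ℝ) * (2 * π * N2) - Γ ≤ A := arch_lower_bound hcells hg
  -- Step C
  have hC : Γ ≤ ∑ k ∈ range n, ∑ l ∈ range n, gHat c k l * z k l + 5 * L ^ 2 * (c.nuPrimeAbs : ℝ) := by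
    have := freq_integral_bound hcells hsc hg (by rwa [← ha_def])
    rw [← ha_def] at this
    exact this
  -- constants
  set q : ℝ := ((invTwoPiHi20 : ℚ) : ℝ) with hq
  set qLo : ℝ := ((invTwoPiLo20 : ℚ) : ℝ) with hqLo
  have hq1 : 1 / (2 * π) ≤ q := invTwoPiHi20_ge
  have hq0 : 0 ≤ q := invTwoPiHi20_nonneg
  have hqLo1 : qLo ≤ 1 / (2 * π) := invTwoPiLo20_le
  have hlogpi : Real.log π ≤ ((logPiHi20 : ℚ) : ℝ) := logPiHi20_ge
  have hν0 : 0 ≤ ((c.nuPrimeAbs : ℚ) : ℝ) := by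
    unfold nuPrimeAbs
    have h1 : (0 : ℝ) ≤ (cellsAbsMomentQ c.base.wL c.cells (c.base.N + 1) : ℝ) := by
      rw [← (integral_stepAux_mul_powV (wL := c.base.wL) hcells.valid (c.base.N + 1)).2]
      refine integral_nonneg fun s' ↦ mul_nonneg ((stepAux_propsV (wL := c.base.wL)
        hcells.valid).1.choose_spec s').1 ?_
      have hev : Even (c.base.N + 1) := ⟨c.base.nb, by omega⟩
      rw [← hev.pow_abs]; positivity
    push_cast
    have ha0 : (0 : ℝ) ≤ (c.base.a0 : ℝ) := by rw [← ha_def]; exact ha.le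
    positivity
  have hpi : 0 < 1 / (2 * π) := by positivity
  -- the signed `Γ`: `−(1/2π)Γ ≥ −qX − (q − qLo)·C₀·7·N2`
  set C₀ : ℝ := ((cellsBndMaxQ c.base.wL c.cells : ℚ) : ℝ) with hC₀
  have hC₀0 : 0 ≤ C₀ := by rw [hC₀]; exact_mod_cast cellsBndMaxQ_nonneg c.base.wL c.cells
  have hγabs : ∀ t, |cellsGamma₂ c.base.wL c.cells t| ≤ C₀ := fun t ↦ by
    rw [hC₀]; exact abs_cellsGamma₂_le_bndMax hcells t
  set ind : ℝ → ℝ := Set.indicator (Icc (-(c.base.T : ℝ)) c.base.T) (fun _ ↦ (1 : ℝ)) with hind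
  have hind01 : ∀ t, 0 ≤ ind t ∧ ind t ≤ 1 := fun t ↦ by
    rw [hind]; by_cases ht : t ∈ Icc (-(c.base.T : ℝ)) c.base.T
    · rw [Set.indicator_of_mem ht]; norm_num
    · rw [Set.indicator_of_notMem ht]; norm_num
  have hindm : Measurable ind := by rw [hind]; exact measurable_const.indicator measurableSet_Icc
  set PiT : ℝ := ∫ t : ℝ, ‖weilMellin g (1 / 2 + t * I)‖ ^ 2 * ind t with hPiT
  have hiPiT : Integrable fun t : ℝ ↦ ‖weilMellin g (1 / 2 + t * I)‖ ^ 2 * ind t :=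
    integrable_norm_sq_weilMellin_mul hg hindm (A := 1) (B := 0) zero_le_one le_rfl fun t ↦ by
      rw [zero_mul, add_zero, abs_of_nonneg (hind01 t).1]; exact (hind01 t).2
  obtain ⟨BΓ, hBΓ0, hBΓ⟩ := exists_abs_cellsGamma₂_le c.base.wL c.cells
  have hiΓ : Integrable fun t : ℝ ↦ ‖weilMellin g (1 / 2 + t * I)‖ ^ 2 * cellsGamma₂ c.base.wL c.cells t :=
    integrable_norm_sq_weilMellin_mul hg (measurable_cellsGamma₂ _ _) hBΓ0 le_rfl (B := 0)
      (fun t ↦ by simpa using hBΓ t)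
  have hPiT0 : 0 ≤ PiT := integral_nonneg fun t ↦ mul_nonneg (sq_nonneg _) (hind01 t).1
  have hPiTle : PiT ≤ 7 * N2 := by
    have h1 : PiT ≤ ∫ t : ℝ, ‖weilMellin g (1 / 2 + t * I)‖ ^ 2 :=
      integral_mono hiPiT (integrable_norm_sq_weilMellin_half_line hg) fun t ↦ by
        simpa using mul_le_mul_of_nonneg_left (hind01 t).2 (sq_nonneg ‖weilMellin g (1 / 2 + t * I)‖)
    rw [integral_norm_sq_weilMellin_half_line hg] at h1
    have h7 : 2 * π ≤ 7 := by linarith [Real.pi_lt_d2]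
    nlinarith
  -- `Γ₊ = Γ + C₀ PiT ≥ 0`
  have hΓplus : 0 ≤ Γ + C₀ * PiT := by
    rw [hΓ, hPiT, ← integral_const_mul, ← integral_add hiΓ (hiPiT.const_mul _)]
    refine integral_nonneg fun t ↦ ?_
    rw [show ‖weilMellin g (1 / 2 + t * I)‖ ^ 2 * cellsGamma₂ c.base.wL c.cells t +
        C₀ * (‖weilMellin g (1 / 2 + t * I)‖ ^ 2 * ind t) =
        ‖weilMellin g (1 / 2 + t * I)‖ ^ 2 * (cellsGamma₂ c.base.wL c.cells t + C₀ * ind t) by ring]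
    refine mul_nonneg (sq_nonneg _) ?_
    by_cases ht : t ∈ Icc (-(c.base.T : ℝ)) c.base.T
    · have : ind t = 1 := by rw [hind, Set.indicator_of_mem ht]
      rw [this, mul_one]
      linarith [neg_abs_le (cellsGamma₂ c.base.wL c.cells t), hγabs t]
    · have : ind t = 0 := by rw [hind, Set.indicator_of_notMem ht]
      have hT' : (c.base.T : ℝ) ≤ |t| := by
        rw [Set.mem_Icc, not_and_or, not_le, not_le] at ht
        rcases ht with ht | ht
        · linarith [neg_abs_le t, le_abs_self t, neg_le_abs t]
        · exact ht.le.trans (le_abs_self t)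
      rw [this, mul_zero, add_zero, cellsGamma₂_eq_zeroV hcells hT']
  have hΓlow : -(q * (∑ k ∈ range n, ∑ l ∈ range n, gHat c k l * z k l + 5 * L ^ 2 * (c.nuPrimeAbs : ℝ))) -
      (q - qLo) * C₀ * (7 * N2) ≤ -(1 / (2 * π) * Γ) := by
    have e : -(1 / (2 * π) * Γ) = -(1 / (2 * π)) * (Γ + C₀ * PiT) + 1 / (2 * π) * (C₀ * PiT) := by ring
    rw [e]
    have h1 : -q * (Γ + C₀ * PiT) ≤ -(1 / (2 * π)) * (Γ + C₀ * PiT) := by nlinarith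
    have h2 : qLo * (C₀ * PiT) ≤ 1 / (2 * π) * (C₀ * PiT) :=
      mul_le_mul_of_nonneg_right hqLo1 (mul_nonneg hC₀0 hPiT0)
    have h3 : q * Γ ≤ q * (∑ k ∈ range n, ∑ l ∈ range n, gHat c k l * z k l + 5 * L ^ 2 * (c.nuPrimeAbs : ℝ)) :=
      mul_le_mul_of_nonneg_left hC hq0
    have hqq : 0 ≤ q - qLo := by linarith [invTwoPiLo20_le_invTwoPiHi20]
    have h4 : (q - qLo) * C₀ * PiT ≤ (q - qLo) * C₀ * (7 * N2) :=
      mul_le_mul_of_nonneg_left hPiTle (mul_nonneg hqq hC₀0)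
    nlinarith
  -- combine A, B, C
  have hB' : (c.base.wL : ℝ) * N2 - 1 / (2 * π) * Γ ≤ 1 / (2 * π) * A := by
    calc (c.base.wL : ℝ) * N2 - 1 / (2 * π) * Γ = 1 / (2 * π) * ((c.base.wL : ℝ) * (2 * π * N2) - Γ) := by
          field_simp
      _ ≤ 1 / (2 * π) * A := mul_le_mul_of_nonneg_left hB hpi.le
  have h5 : Real.log π * N2 ≤ ((logPiHi20 : ℚ) : ℝ) * N2 := mul_le_mul_of_nonneg_right hlogpi hN20
  have step1 : ∑ k ∈ range n, ∑ l ∈ range n,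
      ((if k % 2 = l % 2 then
        (-1 : ℝ) ^ k * 2 * ((a / 2) ^ k / k.factorial) * ((a / 2) ^ l / l.factorial) else 0) -
        q * gHat c k l) * z k l +
      ((c.base.wL : ℝ) - (logPiHi20 : ℚ) - 7 * (q - qLo) * C₀) * N2 -
      ((8 * ρ + 6 * ρ ^ 2) + 5 * q * (c.nuPrimeAbs : ℝ)) * L ^ 2 ≤ P - Real.log π * N2 + 1 / (2 * π) * A := by
    have e1 : ∑ k ∈ range n, ∑ l ∈ range n,
        ((if k % 2 = l % 2 then
          (-1 : ℝ) ^ k * 2 * ((a / 2) ^ k / k.factorial) * ((a / 2) ^ l / l.factorial) else 0) -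
          q * gHat c k l) * z k l =
        ∑ k ∈ range n, ∑ l ∈ range n,
          (if k % 2 = l % 2 then
            (-1 : ℝ) ^ k * 2 * ((a / 2) ^ k / k.factorial) * ((a / 2) ^ l / l.factorial) else 0) * z k l -
        q * ∑ k ∈ range n, ∑ l ∈ range n, gHat c k l * z k l := by
      rw [Finset.mul_sum, ← Finset.sum_sub_distrib]
      refine Finset.sum_congr rfl fun k _ ↦ ?_
      rw [Finset.mul_sum, ← Finset.sum_sub_distrib]
      refine Finset.sum_congr rfl fun l _ ↦ ?_
      ring
    rw [e1]
    linarith [hPA, hB', hΓlow, h5]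
  -- rounding of the matrix and of the moment table, together: `|prQ − Pexact| ≤ δ`
  have hMk : ∀ k, ‖M k‖ ≤ L := fun k ↦ norm_weilMoment_le hg ha hsupp' k
  set q6 : ℝ := ((invTwoPiHi : ℚ) : ℝ) with hq6
  have hq60 : 0 ≤ q6 := invTwoPiHi_nonneg
  set δ : ℝ := 1 / 2 ^ c.base.pg + q6 * (1 / 2 ^ c.pnu) with hδ
  have hδ0 : 0 ≤ δ := by rw [hδ]; positivity
  have hround : ∑ k ∈ range n, ∑ l ∈ range n, ((c.base.prQ nu k l : ℚ) : ℝ) * z k l -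
      ∑ k ∈ range n, ∑ l ∈ range n,
        ((if k % 2 = l % 2 then
          (-1 : ℝ) ^ k * 2 * ((a / 2) ^ k / k.factorial) * ((a / 2) ^ l / l.factorial) else 0) -
          q * gHat c k l) * z k l ≤ δ * (n : ℝ) ^ 2 * L ^ 2 := by
    refine quad_rounding_le' n (fun k l ↦ ((c.base.prQ nu k l : ℚ) : ℝ)) _ δ L hδ0 (fun k hk l hl ↦ ?_) M hMk
    have h1 : |((c.base.prQ nu k l : ℚ) : ℝ) - ((c.base.pmQ nu k l : ℚ) : ℝ)| ≤ 1 / 2 ^ c.base.pg := by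
      rw [abs_sub_comm]
      unfold WeilCert.prQ
      exact abs_cast_sub_ratRd_le c.base.pg (c.base.pmQ nu k l)
    have h2q := abs_pmQ_sub_pmQexact_le hnuchk (by omega : k < c.base.N + 1) (by omega : l < c.base.N + 1)
    have h2 : |((c.base.pmQ nu k l : ℚ) : ℝ) - ((pmQexact c k l : ℚ) : ℝ)| ≤ q6 * (1 / 2 ^ c.pnu) := by
      have h := (Rat.cast_le (K := ℝ)).2 h2q
      rw [hnu, hq6]
      push_cast at h ⊢
      exact h
    have h3 : ((pmQexact c k l : ℚ) : ℝ) =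
        (if k % 2 = l % 2 then
          (-1 : ℝ) ^ k * 2 * ((a / 2) ^ k / k.factorial) * ((a / 2) ^ l / l.factorial) else 0) -
          q * gHat c k l := by
      rw [pmQexact_cast, ha_def, hq]
    rw [hδ, ← h3]
    exact (abs_sub_le _ _ _).trans (add_le_add h1 h2)
  -- κ_exact
  have hcoef : 0 ≤ (8 * ρ + 6 * ρ ^ 2) + 5 * q * (c.nuPrimeAbs : ℝ) + δ * (n : ℝ) ^ 2 :=
    add_nonneg (add_nonneg (by positivity) (mul_nonneg (mul_nonneg (by norm_num) hq0) hν0)) (by positivity)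
  have hkex : ((c.kappaExact : ℚ) : ℝ) =
      ((c.base.wL : ℝ) - (logPiHi20 : ℚ) - 7 * (q - qLo) * C₀) -
        2 * a * ((8 * ρ + 6 * ρ ^ 2) + 5 * q * (c.nuPrimeAbs : ℝ) + δ * (n : ℝ) ^ 2) := by
    rw [hρ, hq, hqLo, hC₀, hn, ha_def, hδ, hq6]
    unfold kappaExact WeilCert.etaP WeilCert.rhoE
    push_cast
    ring
  have hκle : ((c.kappaQ : ℚ) : ℝ) ≤ ((c.kappaExact : ℚ) : ℝ) := by
    unfold kappaQ; exact_mod_cast ratRd_le c.base.pg _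
  have hκ0 : (0 : ℝ) ≤ ((c.kappaQ : ℚ) : ℝ) := by exact_mod_cast hκ
  -- E ≥ Σ pr z + κ N2
  have step3 : ∑ k ∈ range n, ∑ l ∈ range n, ((c.base.prQ nu k l : ℚ) : ℝ) * z k l +
      ((c.kappaQ : ℚ) : ℝ) * N2 ≤ P - Real.log π * N2 + 1 / (2 * π) * A := by
    have h1 : ((c.kappaQ : ℚ) : ℝ) * N2 ≤ ((c.kappaExact : ℚ) : ℝ) * N2 :=
      mul_le_mul_of_nonneg_right hκle hN20
    rw [hkex] at h1
    have h2 := mul_le_mul_of_nonneg_left hL1 hcoef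
    linarith [step1, hround, h1, h2]
  -- Bessel and the algebraic core
  have hbes : 2 * (∑ k ∈ range n, conj (c.base.uVec M k) * M k).re -
      (∑ k ∈ range n, ∑ l ∈ range n, conj (c.base.uVec M k) * c.base.uVec M l * (gramH a k l : ℂ)).re ≤ N2 :=
    weilNorm2Sq_ge_bessel hg ha hsupp' n (c.base.uVec M)
  have hcore : 0 ≤ (∑ k ∈ range n, ∑ l ∈ range n, ((c.base.prQ nu k l : ℚ) : ℝ) * z k l) +
      ((c.kappaQ : ℚ) : ℝ) *
        (2 * (∑ k ∈ range n, conj (c.base.uVec M k) * M k).re -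
          (∑ k ∈ range n, ∑ l ∈ range n,
            conj (c.base.uVec M k) * c.base.uVec M l * (gramH a k l : ℂ)).re) := by
    have := WeilCert.core_nonnegK (c := c.base) (nu := nu) (κ := c.kappaQ) hN hb0 hb1 a ha_def.symm M
    rw [← hn] at this
    exact this
  have h4 := mul_le_mul_of_nonneg_left hbes hκ0
  linarith [step3, h4, hcore]


end WeilCert3

end Literature.NumberTheory.LFunctions
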